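import Summits.CriticalPhenomena.PercolationContinuityZ3.Theorems.PercNearOneGluingNoHeavyQuantThreePortResidualKit
import HarnessLib

/-!
# The three-port residual kit, II: Gladkov's Lemma 1.2 off the observer (three apexes) and the enlarged cell solver interface

builds on p205010 (kernel theorem, internal audit signed; external expert review pending)

Support file (`--supports stmt-CriticalPhenomena-4575`), seat `prim-quant-p1` (gen 5); memo `run/shared/lean/prim/quant/P1-SURPLUS.md` §15.
No definitions, no named facts, no sorries; standard axioms.

`ThreePort.le_one_reached_le_of_cellSolver` (p219849) reduces `Z(3,2)` at a three-port observer `o` (hairs `α, β, γ`, arbitrary finite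
graph off `o`, off-`o` cells `U0, Uab, Uac, Ubc, U3`) to refuting a real system fed with the three Gladkov–Zimin rows.  The tree holds a
second PROVED three-point row, Gladkov's Lemma 1.2 (`gladkov2024_lemma_1_2_prodBernoulli`, ineq-gen-8's 'DT row'):
`q²/P(b iso) + q²/P(c iso) ≤ q + P(a iso)²` with `q = P(a|b|c)`.  This file
* transports it off the observer (`ThreePort.l12_offObserver`, `_apex_b`, `_apex_c`; a-dictionary: `P(a iso) = U0+Ubc`, `P(b iso) = U0+Uac`,
  `P(c iso) = U0+Uab`), exactly as `gz_offObserver` does for GZ (law of `ω ∩ {e | o ∉ e}` = `prodBernoulli` of the weights switched off at `o`);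
* records the division-free consequences `q² ≤ (q + x)(y + r²)` (`ThreePort.sq_le_of_l12`; from `q²/(q+y) ≥ q − y`), six in all;
* states `ThreePort.le_one_reached_le_of_cellSolver₂`: `Z(3,2)` at `o` from any refutation of {cells `≥ 0`, `Σ = 1`, three failed
  exchanges, three GZ rows, SIX weak Lemma-1.2 rows, `Σ_v q_v > 2`}.
WHY.  In the near-dominant-but-balanced hair regime (`V_a = β+γ−βγ−α > 0` small, `κ_a = T_a⁻/V_a` large) the GZ rows alone admit abstract
solutions (p219549's memo §14.8), but the weak row `U0² ≤ (U0+Ubc)(Uab+(U0+Uac)²)` with the caps `Uab ≤ κ_c U0`, `Uac ≤ κ_b U0`, `Ubc ≤ κ_a U0`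
forces `U0 ≥ (1/(1+κ_a) − κ_c)/(1+κ_b)²`, which kills them (memo §15: with both row families the abstract optimum of `Σ` stays `< 2`
on the whole box `[3/10, ½]³`; the box certificates of this seat are built on the present interface).
[cite: Gladkov2024, Lemma 1.2 (2)]; [cite: GladkovZimin2024, Thm. 4.6]; [cite: KozmaNitzan2024, Lemma 2 (p. 6)] (context).
-/

noncomputable section

namespace Summit.CriticalPhenomena.PercolationContinuityZ3.Theorems

open MeasureTheory Set Literature.Probability.LatticeModels Literature.Probability.Percolation
open scoped Classical BigOperators

variable {n : ℕ}

namespace ThreePort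

/-! ### Real algebra: the division-free consequence of Lemma 1.2 -/

/-- From `q²/(x+q) + q²/(y+q) ≤ q + r²` with `q, x, y ≥ 0`: `q² ≤ (x+q)·(y+r²)` (use `q²/(y+q) ≥ q − y`). [this work] -/
theorem sq_le_of_l12 (q x y r : ℝ) (hq : 0 ≤ q) (hx : 0 ≤ x) (hy : 0 ≤ y)
    (h : q ^ 2 / (x + q) + q ^ 2 / (y + q) ≤ q + r ^ 2) : q ^ 2 ≤ (x + q) * (y + r ^ 2) := by
  have h1 : q - y ≤ q ^ 2 / (y + q) := by
    rcases (add_nonneg hy hq).eq_or_lt with h0 | hpos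
    · have hq0 : q = 0 := by linarith
      have hy0 : y = 0 := by linarith
      simp [hq0, hy0]
    · rw [le_div_iff₀ hpos]; nlinarith
  have h2 : q ^ 2 / (x + q) ≤ y + r ^ 2 := by linarith
  rcases (add_nonneg hx hq).eq_or_lt with h0 | hpos
  · have hq0 : q = 0 := by linarith
    rw [hq0]; nlinarith [sq_nonneg r]
  · rwa [div_le_iff₀ hpos, mul_comm] at h2

/-! ### Gladkov's Lemma 1.2 off the observer -/

section OffObserver

variable (w : Sym2 (Fin n) → unitInterval) (o a b c : Fin n)

/-- **Gladkov's Lemma 1.2 for the cells off `o`, apex `a`**: with `R x y` = "`x, y` joined in `openGraph (ω ∩ {e | o ∉ e})`" and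
`U0 = μ(a|b|c)`, `U0²/(Uac + U0) + U0²/(Uab + U0) ≤ U0 + (Ubc + U0)²` (`P(b iso) = Uac + U0`, `P(c iso) = Uab + U0`,
`P(a iso) = Ubc + U0`).  Transport of `gladkov2024_lemma_1_2_prodBernoulli` along `ω ↦ ω ∩ {e | o ∉ e}` (`prodBernoulli_map_inter`).
[cite: Gladkov2024, Lemma 1.2 (2)] -/
theorem l12_offObserver :
    (prodBernoulli w).real {ω | ¬ (openGraph (ω ∩ {e | o ∉ e})).Reachable a b ∧
        ¬ (openGraph (ω ∩ {e | o ∉ e})).Reachable a c ∧ ¬ (openGraph (ω ∩ {e | o ∉ e})).Reachable b c} ^ 2 /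
        ((prodBernoulli w).real {ω | (openGraph (ω ∩ {e | o ∉ e})).Reachable a c ∧
            ¬ (openGraph (ω ∩ {e | o ∉ e})).Reachable a b} +
          (prodBernoulli w).real {ω | ¬ (openGraph (ω ∩ {e | o ∉ e})).Reachable a b ∧
            ¬ (openGraph (ω ∩ {e | o ∉ e})).Reachable a c ∧ ¬ (openGraph (ω ∩ {e | o ∉ e})).Reachable b c}) +
      (prodBernoulli w).real {ω | ¬ (openGraph (ω ∩ {e | o ∉ e})).Reachable a b ∧
        ¬ (openGraph (ω ∩ {e | o ∉ e})).Reachable a c ∧ ¬ (openGraph (ω ∩ {e | o ∉ e})).Reachable b c} ^ 2 /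
        ((prodBernoulli w).real {ω | (openGraph (ω ∩ {e | o ∉ e})).Reachable a b ∧
            ¬ (openGraph (ω ∩ {e | o ∉ e})).Reachable a c} +
          (prodBernoulli w).real {ω | ¬ (openGraph (ω ∩ {e | o ∉ e})).Reachable a b ∧
            ¬ (openGraph (ω ∩ {e | o ∉ e})).Reachable a c ∧ ¬ (openGraph (ω ∩ {e | o ∉ e})).Reachable b c}) ≤
      (prodBernoulli w).real {ω | ¬ (openGraph (ω ∩ {e | o ∉ e})).Reachable a b ∧
        ¬ (openGraph (ω ∩ {e | o ∉ e})).Reachable a c ∧ ¬ (openGraph (ω ∩ {e | o ∉ e})).Reachable b c} +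
      ((prodBernoulli w).real {ω | (openGraph (ω ∩ {e | o ∉ e})).Reachable b c ∧
            ¬ (openGraph (ω ∩ {e | o ∉ e})).Reachable a b} +
          (prodBernoulli w).real {ω | ¬ (openGraph (ω ∩ {e | o ∉ e})).Reachable a b ∧
            ¬ (openGraph (ω ∩ {e | o ∉ e})).Reachable a c ∧ ¬ (openGraph (ω ∩ {e | o ∉ e})).Reachable b c}) ^ 2 := by
  set D : Set (Sym2 (Fin n)) := {e | o ∉ e} with hD
  set w' : Sym2 (Fin n) → unitInterval := fun e => if e ∈ D then w e else 0 with hw'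
  have hmap : (prodBernoulli w).map (fun ξ : BondConfig (Fin n) => ξ ∩ D) = prodBernoulli w' :=
    prodBernoulli_map_inter w D
  have htr : ∀ S : Set (BondConfig (Fin n)),
      (prodBernoulli w).real ((fun ξ : BondConfig (Fin n) => ξ ∩ D) ⁻¹' S) = (prodBernoulli w').real S := by
    intro S
    rw [← hmap, map_measureReal_apply (Measurable.of_discrete) MeasurableSet.of_discrete]
  set μ := prodBernoulli w with hμ
  set μ' := prodBernoulli w' with hμ'
  have h12 := gladkov2024_lemma_1_2_prodBernoulli w' a b c
  -- the four events of Lemma 1.2 under `μ'`, as `μ`-measures of off-`o` cells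
  have t0 : μ'.real ((openConn a b)ᶜ ∩ (openConn a c)ᶜ ∩ (openConn b c)ᶜ) =
      μ.real {ω | ¬ (openGraph (ω ∩ D)).Reachable a b ∧ ¬ (openGraph (ω ∩ D)).Reachable a c ∧
        ¬ (openGraph (ω ∩ D)).Reachable b c} := by
    rw [← htr]; congr 1; ext ω
    simp only [Set.mem_preimage, Set.mem_inter_iff, Set.mem_compl_iff, openConn, Set.mem_setOf_eq, and_assoc]
  have tb : μ'.real ((openConn a b)ᶜ ∩ (openConn b c)ᶜ) =
      μ.real {ω | (openGraph (ω ∩ D)).Reachable a c ∧ ¬ (openGraph (ω ∩ D)).Reachable a b} +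
        μ.real {ω | ¬ (openGraph (ω ∩ D)).Reachable a b ∧ ¬ (openGraph (ω ∩ D)).Reachable a c ∧
          ¬ (openGraph (ω ∩ D)).Reachable b c} := by
    rw [← htr]
    refine real_eq_add_of_iff μ (fun ω => ?_) (fun ω h1 h2 => h2.2.1 h1.1)
    simp only [Set.mem_preimage, Set.mem_inter_iff, Set.mem_compl_iff, openConn, Set.mem_setOf_eq]
    constructor
    · rintro ⟨h1, h2⟩
      by_cases h3 : (openGraph (ω ∩ D)).Reachable a c
      · exact Or.inl ⟨h3, h1⟩
      · exact Or.inr ⟨h1, h3, h2⟩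
    · rintro (⟨h3, h1⟩ | ⟨h1, -, h2⟩)
      · exact ⟨h1, fun h2 => h1 (h3.trans h2.symm)⟩
      · exact ⟨h1, h2⟩
  have tc : μ'.real ((openConn a c)ᶜ ∩ (openConn b c)ᶜ) =
      μ.real {ω | (openGraph (ω ∩ D)).Reachable a b ∧ ¬ (openGraph (ω ∩ D)).Reachable a c} +
        μ.real {ω | ¬ (openGraph (ω ∩ D)).Reachable a b ∧ ¬ (openGraph (ω ∩ D)).Reachable a c ∧
          ¬ (openGraph (ω ∩ D)).Reachable b c} := by
    rw [← htr]
    refine real_eq_add_of_iff μ (fun ω => ?_) (fun ω h1 h2 => h2.1 h1.1)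
    simp only [Set.mem_preimage, Set.mem_inter_iff, Set.mem_compl_iff, openConn, Set.mem_setOf_eq]
    constructor
    · rintro ⟨h1, h2⟩
      by_cases h3 : (openGraph (ω ∩ D)).Reachable a b
      · exact Or.inl ⟨h3, h1⟩
      · exact Or.inr ⟨h3, h1, h2⟩
    · rintro (⟨h3, h1⟩ | ⟨-, h1, h2⟩)
      · exact ⟨h1, fun h2 => h1 (h3.trans h2)⟩
      · exact ⟨h1, h2⟩
  have ta : μ'.real ((openConn a b)ᶜ ∩ (openConn a c)ᶜ) =
      μ.real {ω | (openGraph (ω ∩ D)).Reachable b c ∧ ¬ (openGraph (ω ∩ D)).Reachable a b} +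
        μ.real {ω | ¬ (openGraph (ω ∩ D)).Reachable a b ∧ ¬ (openGraph (ω ∩ D)).Reachable a c ∧
          ¬ (openGraph (ω ∩ D)).Reachable b c} := by
    rw [← htr]
    refine real_eq_add_of_iff μ (fun ω => ?_) (fun ω h1 h2 => h2.2.2 h1.1)
    simp only [Set.mem_preimage, Set.mem_inter_iff, Set.mem_compl_iff, openConn, Set.mem_setOf_eq]
    constructor
    · rintro ⟨h1, h2⟩
      by_cases h3 : (openGraph (ω ∩ D)).Reachable b c
      · exact Or.inl ⟨h3, h1⟩
      · exact Or.inr ⟨h1, h2, h3⟩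
    · rintro (⟨h3, h1⟩ | ⟨h1, h2, -⟩)
      · exact ⟨h1, fun h2 => h1 (h2.trans h3.symm)⟩
      · exact ⟨h1, h2⟩
  rw [t0, tb, tc, ta] at h12
  exact h12

/-- Gladkov's Lemma 1.2 off `o` at apex `b`, in the `a`-dictionary: `U0²/(Ubc + U0) + U0²/(Uab + U0) ≤ U0 + (Uac + U0)²`.
[cite: Gladkov2024, Lemma 1.2 (2)] -/
theorem l12_offObserver_apex_b :
    (prodBernoulli w).real {ω | ¬ (openGraph (ω ∩ {e | o ∉ e})).Reachable a b ∧
        ¬ (openGraph (ω ∩ {e | o ∉ e})).Reachable a c ∧ ¬ (openGraph (ω ∩ {e | o ∉ e})).Reachable b c} ^ 2 /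
        ((prodBernoulli w).real {ω | (openGraph (ω ∩ {e | o ∉ e})).Reachable b c ∧
            ¬ (openGraph (ω ∩ {e | o ∉ e})).Reachable a b} +
          (prodBernoulli w).real {ω | ¬ (openGraph (ω ∩ {e | o ∉ e})).Reachable a b ∧
            ¬ (openGraph (ω ∩ {e | o ∉ e})).Reachable a c ∧ ¬ (openGraph (ω ∩ {e | o ∉ e})).Reachable b c}) +
      (prodBernoulli w).real {ω | ¬ (openGraph (ω ∩ {e | o ∉ e})).Reachable a b ∧
        ¬ (openGraph (ω ∩ {e | o ∉ e})).Reachable a c ∧ ¬ (openGraph (ω ∩ {e | o ∉ e})).Reachable b c} ^ 2 /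
        ((prodBernoulli w).real {ω | (openGraph (ω ∩ {e | o ∉ e})).Reachable a b ∧
            ¬ (openGraph (ω ∩ {e | o ∉ e})).Reachable a c} +
          (prodBernoulli w).real {ω | ¬ (openGraph (ω ∩ {e | o ∉ e})).Reachable a b ∧
            ¬ (openGraph (ω ∩ {e | o ∉ e})).Reachable a c ∧ ¬ (openGraph (ω ∩ {e | o ∉ e})).Reachable b c}) ≤
      (prodBernoulli w).real {ω | ¬ (openGraph (ω ∩ {e | o ∉ e})).Reachable a b ∧
        ¬ (openGraph (ω ∩ {e | o ∉ e})).Reachable a c ∧ ¬ (openGraph (ω ∩ {e | o ∉ e})).Reachable b c} +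
      ((prodBernoulli w).real {ω | (openGraph (ω ∩ {e | o ∉ e})).Reachable a c ∧
            ¬ (openGraph (ω ∩ {e | o ∉ e})).Reachable a b} +
          (prodBernoulli w).real {ω | ¬ (openGraph (ω ∩ {e | o ∉ e})).Reachable a b ∧
            ¬ (openGraph (ω ∩ {e | o ∉ e})).Reachable a c ∧ ¬ (openGraph (ω ∩ {e | o ∉ e})).Reachable b c}) ^ 2 := by
  have h := l12_offObserver w o b a c
  have s1 : {ω : BondConfig (Fin n) | ¬ (openGraph (ω ∩ {e | o ∉ e})).Reachable b a ∧
      ¬ (openGraph (ω ∩ {e | o ∉ e})).Reachable b c ∧ ¬ (openGraph (ω ∩ {e | o ∉ e})).Reachable a c} =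
      {ω | ¬ (openGraph (ω ∩ {e | o ∉ e})).Reachable a b ∧
        ¬ (openGraph (ω ∩ {e | o ∉ e})).Reachable a c ∧ ¬ (openGraph (ω ∩ {e | o ∉ e})).Reachable b c} := by
    ext ω; simp only [Set.mem_setOf_eq]
    exact ⟨fun ⟨h1, h2, h3⟩ => ⟨fun h => h1 h.symm, h3, h2⟩, fun ⟨h1, h2, h3⟩ => ⟨fun h => h1 h.symm, h3, h2⟩⟩
  have s2 : {ω : BondConfig (Fin n) | (openGraph (ω ∩ {e | o ∉ e})).Reachable b c ∧
      ¬ (openGraph (ω ∩ {e | o ∉ e})).Reachable b a} =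
      {ω | (openGraph (ω ∩ {e | o ∉ e})).Reachable b c ∧ ¬ (openGraph (ω ∩ {e | o ∉ e})).Reachable a b} := by
    ext ω; simp only [Set.mem_setOf_eq]
    exact ⟨fun ⟨h1, h2⟩ => ⟨h1, fun h => h2 h.symm⟩, fun ⟨h1, h2⟩ => ⟨h1, fun h => h2 h.symm⟩⟩
  have s3 : {ω : BondConfig (Fin n) | (openGraph (ω ∩ {e | o ∉ e})).Reachable b a ∧
      ¬ (openGraph (ω ∩ {e | o ∉ e})).Reachable b c} =
      {ω | (openGraph (ω ∩ {e | o ∉ e})).Reachable a b ∧ ¬ (openGraph (ω ∩ {e | o ∉ e})).Reachable a c} := by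
    ext ω; simp only [Set.mem_setOf_eq]
    exact ⟨fun ⟨h1, h2⟩ => ⟨h1.symm, fun h => h2 (h1.trans h)⟩, fun ⟨h1, h2⟩ => ⟨h1.symm, fun h => h2 (h1.trans h)⟩⟩
  have s4 : {ω : BondConfig (Fin n) | (openGraph (ω ∩ {e | o ∉ e})).Reachable a c ∧
      ¬ (openGraph (ω ∩ {e | o ∉ e})).Reachable b a} =
      {ω | (openGraph (ω ∩ {e | o ∉ e})).Reachable a c ∧ ¬ (openGraph (ω ∩ {e | o ∉ e})).Reachable a b} := by
    ext ω; simp only [Set.mem_setOf_eq]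
    exact ⟨fun ⟨h1, h2⟩ => ⟨h1, fun h => h2 h.symm⟩, fun ⟨h1, h2⟩ => ⟨h1, fun h => h2 h.symm⟩⟩
  rw [s1, s2, s3, s4] at h
  exact h

/-- Gladkov's Lemma 1.2 off `o` at apex `c`, in the `a`-dictionary: `U0²/(Ubc + U0) + U0²/(Uac + U0) ≤ U0 + (Uab + U0)²`.
[cite: Gladkov2024, Lemma 1.2 (2)] -/
theorem l12_offObserver_apex_c :
    (prodBernoulli w).real {ω | ¬ (openGraph (ω ∩ {e | o ∉ e})).Reachable a b ∧
        ¬ (openGraph (ω ∩ {e | o ∉ e})).Reachable a c ∧ ¬ (openGraph (ω ∩ {e | o ∉ e})).Reachable b c} ^ 2 /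
        ((prodBernoulli w).real {ω | (openGraph (ω ∩ {e | o ∉ e})).Reachable b c ∧
            ¬ (openGraph (ω ∩ {e | o ∉ e})).Reachable a b} +
          (prodBernoulli w).real {ω | ¬ (openGraph (ω ∩ {e | o ∉ e})).Reachable a b ∧
            ¬ (openGraph (ω ∩ {e | o ∉ e})).Reachable a c ∧ ¬ (openGraph (ω ∩ {e | o ∉ e})).Reachable b c}) +
      (prodBernoulli w).real {ω | ¬ (openGraph (ω ∩ {e | o ∉ e})).Reachable a b ∧
        ¬ (openGraph (ω ∩ {e | o ∉ e})).Reachable a c ∧ ¬ (openGraph (ω ∩ {e | o ∉ e})).Reachable b c} ^ 2 /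
        ((prodBernoulli w).real {ω | (openGraph (ω ∩ {e | o ∉ e})).Reachable a c ∧
            ¬ (openGraph (ω ∩ {e | o ∉ e})).Reachable a b} +
          (prodBernoulli w).real {ω | ¬ (openGraph (ω ∩ {e | o ∉ e})).Reachable a b ∧
            ¬ (openGraph (ω ∩ {e | o ∉ e})).Reachable a c ∧ ¬ (openGraph (ω ∩ {e | o ∉ e})).Reachable b c}) ≤
      (prodBernoulli w).real {ω | ¬ (openGraph (ω ∩ {e | o ∉ e})).Reachable a b ∧
        ¬ (openGraph (ω ∩ {e | o ∉ e})).Reachable a c ∧ ¬ (openGraph (ω ∩ {e | o ∉ e})).Reachable b c} +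
      ((prodBernoulli w).real {ω | (openGraph (ω ∩ {e | o ∉ e})).Reachable a b ∧
            ¬ (openGraph (ω ∩ {e | o ∉ e})).Reachable a c} +
          (prodBernoulli w).real {ω | ¬ (openGraph (ω ∩ {e | o ∉ e})).Reachable a b ∧
            ¬ (openGraph (ω ∩ {e | o ∉ e})).Reachable a c ∧ ¬ (openGraph (ω ∩ {e | o ∉ e})).Reachable b c}) ^ 2 := by
  have h := l12_offObserver w o c a b
  have s1 : {ω : BondConfig (Fin n) | ¬ (openGraph (ω ∩ {e | o ∉ e})).Reachable c a ∧
      ¬ (openGraph (ω ∩ {e | o ∉ e})).Reachable c b ∧ ¬ (openGraph (ω ∩ {e | o ∉ e})).Reachable a b} =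
      {ω | ¬ (openGraph (ω ∩ {e | o ∉ e})).Reachable a b ∧
        ¬ (openGraph (ω ∩ {e | o ∉ e})).Reachable a c ∧ ¬ (openGraph (ω ∩ {e | o ∉ e})).Reachable b c} := by
    ext ω; simp only [Set.mem_setOf_eq]
    exact ⟨fun ⟨h1, h2, h3⟩ => ⟨h3, fun h => h1 h.symm, fun h => h2 h.symm⟩,
      fun ⟨h1, h2, h3⟩ => ⟨fun h => h2 h.symm, fun h => h3 h.symm, h1⟩⟩
  have s2 : {ω : BondConfig (Fin n) | (openGraph (ω ∩ {e | o ∉ e})).Reachable c b ∧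
      ¬ (openGraph (ω ∩ {e | o ∉ e})).Reachable c a} =
      {ω | (openGraph (ω ∩ {e | o ∉ e})).Reachable b c ∧ ¬ (openGraph (ω ∩ {e | o ∉ e})).Reachable a b} := by
    ext ω; simp only [Set.mem_setOf_eq]
    exact ⟨fun ⟨h1, h2⟩ => ⟨h1.symm, fun h => h2 ((h.trans h1.symm).symm)⟩,
      fun ⟨h1, h2⟩ => ⟨h1.symm, fun h => h2 (h.symm.trans h1.symm)⟩⟩
  have s3 : {ω : BondConfig (Fin n) | (openGraph (ω ∩ {e | o ∉ e})).Reachable c a ∧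
      ¬ (openGraph (ω ∩ {e | o ∉ e})).Reachable c b} =
      {ω | (openGraph (ω ∩ {e | o ∉ e})).Reachable a c ∧ ¬ (openGraph (ω ∩ {e | o ∉ e})).Reachable a b} := by
    ext ω; simp only [Set.mem_setOf_eq]
    exact ⟨fun ⟨h1, h2⟩ => ⟨h1.symm, fun h => h2 (h1.trans h)⟩, fun ⟨h1, h2⟩ => ⟨h1.symm, fun h => h2 (h1.trans h)⟩⟩
  have s4 : {ω : BondConfig (Fin n) | (openGraph (ω ∩ {e | o ∉ e})).Reachable a b ∧
      ¬ (openGraph (ω ∩ {e | o ∉ e})).Reachable c a} =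
      {ω | (openGraph (ω ∩ {e | o ∉ e})).Reachable a b ∧ ¬ (openGraph (ω ∩ {e | o ∉ e})).Reachable a c} := by
    ext ω; simp only [Set.mem_setOf_eq]
    exact ⟨fun ⟨h1, h2⟩ => ⟨h1, fun h => h2 h.symm⟩, fun ⟨h1, h2⟩ => ⟨h1, fun h => h2 h.symm⟩⟩
  rw [s1, s2, s3, s4] at h
  exact h

end OffObserver

/-! ### `Z(3,2)` at a three-port observer from a cell solver fed with both row families -/

/-- **`Z(3,2)` at a three-port observer, from any real-algebra cell solver using the GZ rows AND the six division-free Lemma-1.2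
rows** `U0² ≤ (U0 + X_u)(X_w + (U0 + X_v)²)` (`{u,v,w} = {a,b,c}`, `X_a = Ubc, X_b = Uac, X_c = Uab`).  Same frame as
`le_one_reached_le_of_cellSolver`. [this work] -/
theorem le_one_reached_le_of_cellSolver₂ (w : Sym2 (Fin n) → unitInterval) (R : Finset (Fin n)) (o a b c : Fin n) (t : ℝ)
    (hR : R = {a, b, c}) (hao : a ≠ o) (hbo : b ≠ o) (hco : c ≠ o) (hab : a ≠ b) (hac : a ≠ c) (hbc : b ≠ c)
    (hobs : ∀ u, u ≠ o → u ≠ a → u ≠ b → u ≠ c → w s(o, u) = 0)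
    (hsolve : ∀ U0 Uab Uac Ubc U3 : ℝ, 0 ≤ U0 → 0 ≤ Uab → 0 ≤ Uac → 0 ≤ Ubc → 0 ≤ U3 →
      Uab + Uac + Ubc + U3 + U0 = 1 →
      U0 * ((1 - (w s(o, a) : ℝ)) * w s(o, b) * w s(o, c) - w s(o, a) * (1 - w s(o, b)) * (1 - w s(o, c))) +
        Ubc * (w s(o, b) + w s(o, c) - w s(o, b) * w s(o, c) - w s(o, a)) < 0 →
      U0 * ((1 - (w s(o, b) : ℝ)) * w s(o, a) * w s(o, c) - w s(o, b) * (1 - w s(o, a)) * (1 - w s(o, c))) +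
        Uac * (w s(o, a) + w s(o, c) - w s(o, a) * w s(o, c) - w s(o, b)) < 0 →
      U0 * ((1 - (w s(o, c) : ℝ)) * w s(o, a) * w s(o, b) - w s(o, c) * (1 - w s(o, a)) * (1 - w s(o, b))) +
        Uab * (w s(o, a) + w s(o, b) - w s(o, a) * w s(o, b) - w s(o, c)) < 0 →
      (U0 + Ubc) * (Uab + Uac + U3) ≤ Uab + Uac + Ubc →
      (U0 + Uac) * (Uab + Ubc + U3) ≤ Uab + Uac + Ubc →
      (U0 + Uab) * (Uac + Ubc + U3) ≤ Uab + Uac + Ubc →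
      U0 ^ 2 ≤ (Uac + U0) * (Uab + (Ubc + U0) ^ 2) → U0 ^ 2 ≤ (Uab + U0) * (Uac + (Ubc + U0) ^ 2) →
      U0 ^ 2 ≤ (Ubc + U0) * (Uab + (Uac + U0) ^ 2) → U0 ^ 2 ≤ (Uab + U0) * (Ubc + (Uac + U0) ^ 2) →
      U0 ^ 2 ≤ (Ubc + U0) * (Uac + (Uab + U0) ^ 2) → U0 ^ 2 ≤ (Uac + U0) * (Ubc + (Uab + U0) ^ 2) →
      2 < ((w s(o, a) : ℝ) + w s(o, b) + w s(o, c)) + (w s(o, a) + w s(o, b) - 2 * w s(o, a) * w s(o, b)) * Uab +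
        (w s(o, a) + w s(o, c) - 2 * w s(o, a) * w s(o, c)) * Uac + (w s(o, b) + w s(o, c) - 2 * w s(o, b) * w s(o, c)) * Ubc +
        ((1 - w s(o, a)) * (w s(o, b) + w s(o, c) - w s(o, b) * w s(o, c)) +
          (1 - w s(o, b)) * (w s(o, a) + w s(o, c) - w s(o, a) * w s(o, c)) +
          (1 - w s(o, c)) * (w s(o, a) + w s(o, b) - w s(o, a) * w s(o, b))) * U3 → False)
    (hsum : 2 < (prodBernoulli w).real (openConn o a) + (prodBernoulli w).real (openConn o b) +
      (prodBernoulli w).real (openConn o c))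
    (hta : (prodBernoulli w).real (openConn o a)ᶜ ≤ t) (htb : (prodBernoulli w).real (openConn o b)ᶜ ≤ t)
    (htc : (prodBernoulli w).real (openConn o c)ᶜ ≤ t) :
    (prodBernoulli w).real {ω : BondConfig (Fin n) | (R.filter fun v => ω ∈ openConn o v).card ≤ 1} ≤ t := by
  have ha : a ∈ R := (by simp [hR]); have hb : b ∈ R := (by simp [hR]); have hc : c ∈ R := by simp [hR]
  by_cases hA : (prodBernoulli w).real {ω | ω ∈ openConn o a ∧ ω ∉ openConn o b ∧ ω ∉ openConn o c} ≤
      (prodBernoulli w).real {ω | ω ∉ openConn o a ∧ ω ∈ openConn o b ∧ ω ∈ openConn o c}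
  · exact (OneCutFive.measureReal_le_one_le_compl_of_exchange w R o a b c ha hb hc hab hac hbc hA).trans hta
  by_cases hB : (prodBernoulli w).real {ω | ω ∈ openConn o b ∧ ω ∉ openConn o a ∧ ω ∉ openConn o c} ≤
      (prodBernoulli w).real {ω | ω ∉ openConn o b ∧ ω ∈ openConn o a ∧ ω ∈ openConn o c}
  · exact (OneCutFive.measureReal_le_one_le_compl_of_exchange w R o b a c hb ha hc hab.symm hbc hac hB).trans htb
  by_cases hC : (prodBernoulli w).real {ω | ω ∈ openConn o c ∧ ω ∉ openConn o a ∧ ω ∉ openConn o b} ≤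
      (prodBernoulli w).real {ω | ω ∉ openConn o c ∧ ω ∈ openConn o a ∧ ω ∈ openConn o b}
  · exact (OneCutFive.measureReal_le_one_le_compl_of_exchange w R o c a b hc ha hb hac.symm hbc.symm hab hC).trans htc
  exfalso
  push Not at hA hB hC
  have hobs' : ∀ u, u ≠ o → u ≠ b → u ≠ a → u ≠ c → w s(o, u) = 0 := fun u h1 h2 h3 h4 => hobs u h1 h3 h2 h4
  have hobs'' : ∀ u, u ≠ o → u ≠ c → u ≠ a → u ≠ b → w s(o, u) = 0 := fun u h1 h2 h3 h4 => hobs u h1 h3 h4 h2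
  have hma := margin_eq w o a b c hao hbo hco hab hac hbc hobs
  have hmb := margin_eq w o b a c hbo hao hco hab.symm hbc hac hobs'
  have hmc := margin_eq w o c a b hco hao hbo hac.symm hbc.symm hab hobs''
  have hqa := real_openConn w o a b c hao hbo hco hab hac hbc hobs
  have hqb := real_openConn_b w o a b c hao hbo hco hab hac hbc hobs
  have hqc := real_openConn_c w o a b c hao hbo hco hab hac hbc hobs
  have hcells := cells_sum_eq_one w o a b c
  have hGZa := gz_offObserver w o a b c
  have hGZb := gz_offObserver_apex_b w o a b c
  have hGZc := gz_offObserver_apex_c w o a b c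
  have hLa := l12_offObserver w o a b c
  have hLb := l12_offObserver_apex_b w o a b c
  have hLc := l12_offObserver_apex_c w o a b c
  have s1 : {ω : BondConfig (Fin n) | ¬ (openGraph (ω ∩ {e | o ∉ e})).Reachable b a ∧
      ¬ (openGraph (ω ∩ {e | o ∉ e})).Reachable b c ∧ ¬ (openGraph (ω ∩ {e | o ∉ e})).Reachable a c} =
      {ω | ¬ (openGraph (ω ∩ {e | o ∉ e})).Reachable a b ∧
        ¬ (openGraph (ω ∩ {e | o ∉ e})).Reachable a c ∧ ¬ (openGraph (ω ∩ {e | o ∉ e})).Reachable b c} := by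
    ext ω; simp only [Set.mem_setOf_eq]
    exact ⟨fun ⟨h1, h2, h3⟩ => ⟨fun h => h1 h.symm, h3, h2⟩, fun ⟨h1, h2, h3⟩ => ⟨fun h => h1 h.symm, h3, h2⟩⟩
  have s2 : {ω : BondConfig (Fin n) | (openGraph (ω ∩ {e | o ∉ e})).Reachable a c ∧
      ¬ (openGraph (ω ∩ {e | o ∉ e})).Reachable b a} =
      {ω | (openGraph (ω ∩ {e | o ∉ e})).Reachable a c ∧ ¬ (openGraph (ω ∩ {e | o ∉ e})).Reachable a b} := by
    ext ω; simp only [Set.mem_setOf_eq]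
    exact ⟨fun ⟨h1, h2⟩ => ⟨h1, fun h => h2 h.symm⟩, fun ⟨h1, h2⟩ => ⟨h1, fun h => h2 h.symm⟩⟩
  have s3 : {ω : BondConfig (Fin n) | ¬ (openGraph (ω ∩ {e | o ∉ e})).Reachable c a ∧
      ¬ (openGraph (ω ∩ {e | o ∉ e})).Reachable c b ∧ ¬ (openGraph (ω ∩ {e | o ∉ e})).Reachable a b} =
      {ω | ¬ (openGraph (ω ∩ {e | o ∉ e})).Reachable a b ∧
        ¬ (openGraph (ω ∩ {e | o ∉ e})).Reachable a c ∧ ¬ (openGraph (ω ∩ {e | o ∉ e})).Reachable b c} := by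
    ext ω; simp only [Set.mem_setOf_eq]
    exact ⟨fun ⟨h1, h2, h3⟩ => ⟨h3, fun h => h1 h.symm, fun h => h2 h.symm⟩,
      fun ⟨h1, h2, h3⟩ => ⟨fun h => h2 h.symm, fun h => h3 h.symm, h1⟩⟩
  have s4 : {ω : BondConfig (Fin n) | (openGraph (ω ∩ {e | o ∉ e})).Reachable a b ∧
      ¬ (openGraph (ω ∩ {e | o ∉ e})).Reachable c a} =
      {ω | (openGraph (ω ∩ {e | o ∉ e})).Reachable a b ∧ ¬ (openGraph (ω ∩ {e | o ∉ e})).Reachable a c} := by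
    ext ω; simp only [Set.mem_setOf_eq]
    exact ⟨fun ⟨h1, h2⟩ => ⟨h1, fun h => h2 h.symm⟩, fun ⟨h1, h2⟩ => ⟨h1, fun h => h2 h.symm⟩⟩
  rw [s1, s2] at hmb
  rw [s3, s4] at hmc
  rw [hqa, hqb, hqc, sigma_cells_collect] at hsum
  -- abbreviate the five cells
  set μ := prodBernoulli w with hμ
  set U0 : ℝ := μ.real {ω : BondConfig (Fin n) | ¬ (openGraph (ω ∩ {e | o ∉ e})).Reachable a b ∧
      ¬ (openGraph (ω ∩ {e | o ∉ e})).Reachable a c ∧ ¬ (openGraph (ω ∩ {e | o ∉ e})).Reachable b c} with hU0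
  set Uab : ℝ := μ.real {ω : BondConfig (Fin n) | (openGraph (ω ∩ {e | o ∉ e})).Reachable a b ∧
      ¬ (openGraph (ω ∩ {e | o ∉ e})).Reachable a c} with hUab
  set Uac : ℝ := μ.real {ω : BondConfig (Fin n) | (openGraph (ω ∩ {e | o ∉ e})).Reachable a c ∧
      ¬ (openGraph (ω ∩ {e | o ∉ e})).Reachable a b} with hUac
  set Ubc : ℝ := μ.real {ω : BondConfig (Fin n) | (openGraph (ω ∩ {e | o ∉ e})).Reachable b c ∧
      ¬ (openGraph (ω ∩ {e | o ∉ e})).Reachable a b} with hUbc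
  set U3 : ℝ := μ.real {ω : BondConfig (Fin n) | (openGraph (ω ∩ {e | o ∉ e})).Reachable a b ∧
      (openGraph (ω ∩ {e | o ∉ e})).Reachable a c} with hU3
  have h0 : 0 ≤ U0 := measureReal_nonneg
  have habn : 0 ≤ Uab := measureReal_nonneg
  have hacn : 0 ≤ Uac := measureReal_nonneg
  have hbcn : 0 ≤ Ubc := measureReal_nonneg
  have h3n : 0 ≤ U3 := measureReal_nonneg
  -- the six division-free Lemma-1.2 rows
  have rA1 := sq_le_of_l12 U0 Uac Uab (Ubc + U0) h0 hacn habn hLa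
  have rA2 := sq_le_of_l12 U0 Uab Uac (Ubc + U0) h0 habn hacn (by rw [add_comm (U0 ^ 2 / (Uab + U0))]; exact hLa)
  have rB1 := sq_le_of_l12 U0 Ubc Uab (Uac + U0) h0 hbcn habn hLb
  have rB2 := sq_le_of_l12 U0 Uab Ubc (Uac + U0) h0 habn hbcn (by rw [add_comm (U0 ^ 2 / (Uab + U0))]; exact hLb)
  have rC1 := sq_le_of_l12 U0 Ubc Uac (Uab + U0) h0 hbcn hacn hLc
  have rC2 := sq_le_of_l12 U0 Uac Ubc (Uab + U0) h0 hacn hbcn (by rw [add_comm (U0 ^ 2 / (Uac + U0))]; exact hLc)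
  exact hsolve U0 Uab Uac Ubc U3 h0 habn hacn hbcn h3n hcells (by linarith [hma, hA]) (by linarith [hmb, hB])
    (by linarith [hmc, hC]) hGZa hGZb hGZc rA1 rA2 rB1 rB2 rC1 rC2 hsum

end ThreePort

end Summit.CriticalPhenomena.PercolationContinuityZ3.Theorems

end
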